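import Summits.BirchSwinnertonDyer.BirchSwinnertonDyer.Theorems.EisensteinPrimesGoodLatticeBDPValueOfNamedFactsV26
import Summits.BirchSwinnertonDyer.BirchSwinnertonDyer.Theorems.EisensteinPrimesGoodLatticeBDPValueFullDescentFiveLe
import HarnessLib
/-!
# Crux `GoodLatticeBDPValue` (stmt-BirchSwinnertonDyer-19032), line `halves`: THE CRUX BY NAME FROM TEN LITERATURE NAMED FACTS
# — the v26 surface with the `5 ≤ p` slice of [AN] DERIVED from 3a-A's name by the unconditional T‴ (the closure for the LEAD's v27)

Cell `bsd-eis` (run/shared/lean/pub/bsd-eis/), LEAD seat `bsd-line-x1-p1` gen 7. `--supports stmt-BirchSwinnertonDyer-19032`.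
On the v26 surface (`GoodLatticeBDPValueOfNamedFactsV26.goodLatticeBDPValue_of_namedFacts₂₆`, p674045: cycWL discharged) the crux BY NAME is
conditional on ELEVEN Literature named facts. Width seats w7 gen 7 / w3 gen 13 / w6 gen 8 / w5 gen 6 (road R5 / AN-5) proved UNCONDITIONALLY the
`5 ≤ p` twin T‴ of the closed stub 3a-B — `GoodLatticeBDPValueFullDescentFiveLe.fullDescentDatum_of_five_le` (p673546): for `5 ≤ p`, `Good W p`,
`Red W p` and the good-lattice normalisation, `E` has an additive prime or a multiplicative `ℓ` split with `ℓ ≡ 1 (mod p)` or non-split with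
`ℓ ≡ −1 (mod p)` (Theorem A′ on `E[p²]`, Herbrand splitting, line characters at multiplicative places) — and the bridge
`GoodLatticeBDPValueFullDescentFiveLe.thm222_anacong_goodLattice_of_five_le_of_fullDescentDatum :
KellerYin2024.thm222_anacong_goodLattice_of_fullDescentDatum → KellerYin2024.thm222_anacong_goodLattice_of_five_le`. So the composed-print fact
`_of_five_le` (stub 4b conjunct 2 since v19) is DERIVED from stub 3a-A's NAME and leaves the by-name surface.

Result: `goodLatticeBDPValue_of_namedFacts₂₇ : ⟨proofThm422 ∧ thm513_disc ∧ thm331 ∧ thmII64⟩ → thm222_anacong_goodLattice_of_fullDescentDatum →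
⟨prop411 ∧ (∀ L, tateGlobalEulerPoincareCharacteristic L) ∧ (∀ L, poitouTate_restricted_three_le L)⟩ → ⟨prop263 ∧ thm212⟩ →
Theses.EisensteinPrimes.GoodLatticeBDPValue` — ₂₆ with the `_of_five_le` slot filled by the bridge at the 3a-A hypothesis. The crux BY NAME is
thereby conditional on exactly TEN Literature named facts (research 7: CGLS 2022 proof of Thm. 4.2.2, Thm. 5.1.3 (disc), Thm. 2.1.2; Bleher et al.
2020 Thm. 3.3.1; de Shalit 1987 II.6.4; Greenberg 2016 Props. 4.1.1, 2.6.3; composed-print 1: `KellerYin2024.thm222_anacong_goodLattice_of_fullDescentDatum`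
(label under referee C3 review); textbook 2: Milne ADT I Thm. 5.1, Harari Thm. 17.13 (a)). HONEST FRAMING: a CONDITIONAL theorem (audit
`proof.conditional`, ten names); it closes nothing; no summit statement / BSD / KY Thm. 2.2.2 / the crux is proved here; 0 cells / labels move.
References: those of p674045, p673546 and of the skeleton `Cruxes/GoodLatticeBDPValue/Lines/halves.lean`.
-/

-- `Summit.BirchSwinnertonDyer.BirchSwinnertonDyer.…`: the summit and its single sub-problem share a name (D-0017 layout).
set_option linter.dupNamespace false
set_option autoImplicit false

namespace Summit.BirchSwinnertonDyer.BirchSwinnertonDyer.Theorems.GoodLatticeBDPValueOfNamedFactsV27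

open scoped Classical

open PowerSeries WeierstrassCurve NumberField IsDedekindDomain Field
  Literature.NumberTheory.GaloisRepresentations Literature.NumberTheory.EllipticCurves.GreenbergVatsal2000
  Summit.BirchSwinnertonDyer.BirchSwinnertonDyer.Theorems.EisensteinPrimesMuLambda
  Literature.NumberTheory.EllipticCurves Literature.NumberTheory.EllipticCurves.ModularForms
  Literature.NumberTheory.EllipticCurves.Rank1Residual Literature.NumberTheory.EllipticCurves.Castella2018
  Literature.NumberTheory.EllipticCurves.GreenbergSelmer Literature.NumberTheory.QuadraticFields
  Literature.NumberTheory.EllipticCurves.CastellaGrossiLeeSkinner2022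
  Literature.NumberTheory.EllipticCurves.KellerYin2024 Literature.NumberTheory.EllipticCurves.IwasawaAlgebra
  Literature.NumberTheory.EllipticCurves.Rubin1991 Literature.NumberTheory.EllipticCurves.DeShalit1987
  Literature.NumberTheory.EllipticCurves.Hida2010MuInvariant Literature.NumberTheory.EllipticCurves.BCGKPST2020
open Literature.NumberTheory.IwasawaTheory Literature.NumberTheory.IwasawaTheory.Greenberg2016
  Literature.NumberTheory.IwasawaTheory.Greenberg2006
open Summit.BirchSwinnertonDyer.BirchSwinnertonDyer.Theorems

/-- **THE CRUX BY NAME — `Theses.EisensteinPrimes.GoodLatticeBDPValue` — from TEN LITERATURE NAMED FACTS (the v27 surface)**: stub 1's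
four BDP / CM facts; 3a-A as the named fact `KellerYin2024.thm222_anacong_goodLattice_of_fullDescentDatum` (p666692); stub 4 = Greenberg 2016
Prop. 4.1.1 and the two textbook duality facts (cycWL discharged, p672832); stub 4b = Greenberg 2016 Prop. 2.6.3 and CGLS Thm. 2.1.2 — the
`5 ≤ p` slice `_of_five_le` being DERIVED from 3a-A's name by the unconditional T‴ bridge
`GoodLatticeBDPValueFullDescentFiveLe.thm222_anacong_goodLattice_of_five_le_of_fullDescentDatum` (p673546); by LEAD g7's ₂₆ (p674045).
CONDITIONAL on exactly these ten names; closes nothing by itself; BSD is proved for no curve.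
[claim: KellerYin2024, status: under-review]
[cite: KellerYin2024, Thm. 3.0.8 (IMC2) and proof (arXiv:2402.12781v2 TeX L1631–1640), Thm. 1.4.1, proof of Thm. 1.5.1, Thms. 2.2.1–2.2.3]
[cite: CastellaGrossiLeeSkinner2022, proof of Thm. 4.2.2, Thm. 5.1.3 with (disc), Thm. 2.1.2, Thms. 2.2.1/2.2.2 with (2.16), proof of Thm. 1.5.1, Prop. 1.2.5]
[cite: Kriz2016, Thm. 3, Def. 31 (5), Rem. 33, Thm. 34 (3), Thm. 35] [cite: BleherEtAl2020, §3.3 Thm. 3.3.1] [cite: deShalit1987, II.6.4 Theorem (i)]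
[cite: Greenberg2016Selmer, Prop. 4.1.1, Prop. 2.6.3] [cite: MilneADT2006, I Thm. 5.1] [cite: Harari2020, Thm. 17.13 (a)] [cite: PollackWeston2011, App. A Prop. A.2] -/
theorem goodLatticeBDPValue_of_namedFacts₂₇
    (stub_publishedFacts :
      proofThm422_exists_isBDPLFunction_isTorsion_charIdeal_dvd ∧
        thm513_exists_isBDPLFunction_valueAtOne_disc ∧
        thm331_rubin_exists_katzMeasure₂_pseudoIso_span_eq ∧
        thmII64_katzMeasure₂_functionalEquation)
    (stub_anacongOfFullDescentDatum : thm222_anacong_goodLattice_of_fullDescentDatum)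
    (stub_publishedFactsGreenberg :
      prop411_selmer_isAlmostDivisible ∧
        (∀ (L : Type) [Field L] [NumberField L], Literature.NumberTheory.GaloisCohomology.tateGlobalEulerPoincareCharacteristic L) ∧
        (∀ (L : Type) [Field L] [NumberField L], Literature.NumberTheory.GaloisCohomology.poitouTate_restricted_three_le L))
    (stub_publishedFactsMore : prop263_sur_of_crk ∧ thm212_exists_isKatzLFunction) :
    Summit.BirchSwinnertonDyer.BirchSwinnertonDyer.Theses.EisensteinPrimes.GoodLatticeBDPValue :=
  GoodLatticeBDPValueOfNamedFactsV26.goodLatticeBDPValue_of_namedFacts₂₆ stub_publishedFacts stub_anacongOfFullDescentDatum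
    stub_publishedFactsGreenberg
    ⟨stub_publishedFactsMore.1,
      GoodLatticeBDPValueFullDescentFiveLe.thm222_anacong_goodLattice_of_five_le_of_fullDescentDatum stub_anacongOfFullDescentDatum,
      stub_publishedFactsMore.2⟩

end Summit.BirchSwinnertonDyer.BirchSwinnertonDyer.Theorems.GoodLatticeBDPValueOfNamedFactsV27
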